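import Mathlib
import Summits.NavierStokesRegularity.NavierStokesRegularity.Theorems.TaoLadderRungTwoBreakBlowupRigidityOnePinnedExtraction
import Summits.NavierStokesRegularity.NavierStokesRegularity.Theorems.TaoLadderRungTwoBreakBlowupRigidityOnePeriodicCompanionBounded
import HarnessLib

/-!
# SUB-UNITARITY IS AUTOMATIC: the delay of a shift-periodic eternal solution under a geometric envelope of ratio
  `θ` obeys `e^{2T'} ≤ θ`; hence the periodic ω-limit of a type-I pinned, asymptotically shift-periodic robust
  blow-up with retention `μ < 1` is a SUB-UNITARY (S₁)-surviving DSS wave, and the crux K2(1)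
  `TaoLadderRungTwoBreak.BlowupRigidityOne` (stmt-NavierStokesRegularity-20206) follows BY NAME from a bundle whose
  only statement about the delay `T'` is the asymptotic periodicity itself

Route-independent sequel to `…PeriodicPinnedExtraction` (p819787; no `Theses` import here). MODEL lattice ODEs only (Tao 2016 §4 (4.8)/(4.12), §6.4); nothing
here is a statement about the Navier–Stokes equations; NO item is closed (`--supports stmt-NavierStokesRegularity-20206`).
Route-independent (general `m`; `m = 4` in the crux-shaped corollary); DEF-FREE.

* `exp_delay_le_of_envelope_shiftPeriodic` — a non-trivial shift-`(q,T')`-periodic family with two-sided envelope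
  `e^{2σ}‖W_n(σ)‖² ≤ Cₑ θ^n` has `e^{2T'} ≤ θ` (along the period the renormalised energy is multiplied by `e^{2qT'}`
  and bounded by `Cₑ θ^{n₀+kq}`);
* `periodicEnvelopedEternalLimit_of_pinned` — the periodic pinned extraction of p819787 with the limit's envelope
  `e^{2σ}‖W∞_n(σ)‖² ≤ Cₑ κ₂ (Λ²μ)^n` kept;
* `dssMu_le_of_periodicPinned` — hence the limit's delay has `μ_DSS = e^{2T'}/(1+ε₀)^5 ≤ μ` (the blow-up's retention);
* `survivingDSSWave_of_periodicPinned_of_lt_one` — the conclusion of the crux for one table, from: type I + pinning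
  at `(1+ε₀)⁻¹ ≤ μ < 1` + asymptotic `(q,T')`-periodicity along the firing centres (`q ≥ 1`, `T' > 0`) — NO separate
  hypothesis on `T'` (the by-name corollary for the crux lives in the leaf file `…PeriodicPinnedLinks`, keeping this
  module out of the route file's import cone).

HONEST LABEL: the bundle (type I N-39, pinning (E2), asymptotic periodicity of the renormalised blow-up) is OPEN and
research-level; no stub, crux or summit is proved; rung 0.
-/

noncomputable section

-- the summit and its single sub-problem share the name (CONVENTIONS §1)
set_option linter.dupNamespace false

open Set Filter Topology MeasureTheory

namespace Summit.NavierStokesRegularity.NavierStokesRegularity.Theorems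

namespace BlowupRigidityOne

open Literature.Analysis.FluidPDE Literature.Analysis.FluidPDE.TaoCascade

variable {m : ℕ}

/-- **The delay of a non-trivial shift-periodic family under a geometric envelope: `e^{2T'} ≤ θ`.** If
`W_{n+q}(σ) = W_n(σ - qT')` (`q ≥ 1`), `e^{2σ}‖W_n(σ)‖² ≤ Cₑ θ^n` (`θ > 0`) for all `n, σ`, and `W_{n₀}(σ₀) ≠ 0`, then
`e^{2T'} ≤ θ`: along `(n₀ + kq, σ₀ + kqT')` the value is constant while the weight grows by `e^{2kqT'}` against the
allowance `θ^{kq}`. [cite: Tao2016AveragedNS, §4 Lemma 4.1 (4.8)–(4.10) in self-similar variables; cell vocabulary] -/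
theorem exp_delay_le_of_envelope_shiftPeriodic {T' Cₑ θ : ℝ} {W : ℤ → ℝ → Em m} {q : ℕ} (hq : 0 < q)
    (hper : ∀ (n : ℤ) (σ : ℝ), W (n + q) σ = W n (σ - q * T')) (hθ : 0 < θ)
    (henv : ∀ (n : ℤ) (σ : ℝ), Real.exp (2 * σ) * ‖W n σ‖ ^ 2 ≤ Cₑ * θ ^ n)
    {n₀ : ℤ} {σ₀ : ℝ} (hne : W n₀ σ₀ ≠ 0) : Real.exp (2 * T') ≤ θ := by
  set v : ℝ := Real.exp (2 * σ₀) * ‖W n₀ σ₀‖ ^ 2 with hv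
  have hv0 : 0 < v := by
    have : 0 < ‖W n₀ σ₀‖ := norm_pos_iff.2 hne
    positivity
  -- along the period: constant value, weight `e^{2kqT'}`, allowance `θ^{n₀} (θ^q)^k`
  have hk : ∀ k : ℕ, (Real.exp (2 * T') ^ q) ^ k * v ≤ Cₑ * θ ^ n₀ * (θ ^ q) ^ k := by
    intro k
    have hval : W (n₀ + (k : ℤ) * (q : ℤ)) (σ₀ + (k : ℝ) * (q : ℝ) * T') = W n₀ σ₀ := by
      rw [shiftPeriodic_iterate hper k n₀]; ring_nf
    have h := henv (n₀ + (k : ℤ) * (q : ℤ)) (σ₀ + (k : ℝ) * (q : ℝ) * T')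
    rw [hval] at h
    have hexp : Real.exp (2 * (σ₀ + (k : ℝ) * (q : ℝ) * T')) = (Real.exp (2 * T') ^ q) ^ k * Real.exp (2 * σ₀) := by
      rw [← pow_mul, ← Real.exp_nat_mul, ← Real.exp_add]; push_cast; ring_nf
    have hz : θ ^ (n₀ + (k : ℤ) * (q : ℤ)) = θ ^ n₀ * (θ ^ q) ^ k := by
      rw [zpow_add₀ hθ.ne', show ((k : ℤ) * (q : ℤ)) = ((q * k : ℕ) : ℤ) by push_cast; ring, zpow_natCast,
        pow_mul]
    rw [hexp, hz] at h
    calc (Real.exp (2 * T') ^ q) ^ k * v = (Real.exp (2 * T') ^ q) ^ k * Real.exp (2 * σ₀) * ‖W n₀ σ₀‖ ^ 2 := by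
          rw [hv]; ring
      _ ≤ Cₑ * (θ ^ n₀ * (θ ^ q) ^ k) := h
      _ = Cₑ * θ ^ n₀ * (θ ^ q) ^ k := by ring
  -- hence the ratio `(e^{2T'}/θ)^q` has bounded powers, so it is `≤ 1`
  have hθq : 0 < θ ^ q := pow_pos hθ q
  set r : ℝ := Real.exp (2 * T') ^ q / θ ^ q with hr
  have hr_bdd : ∀ k : ℕ, r ^ k ≤ Cₑ * θ ^ n₀ / v := by
    intro k
    rw [le_div_iff₀ hv0, hr, div_pow, div_mul_eq_mul_div, div_le_iff₀ (pow_pos hθq k)]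
    calc (Real.exp (2 * T') ^ q) ^ k * v ≤ Cₑ * θ ^ n₀ * (θ ^ q) ^ k := hk k
      _ = Cₑ * θ ^ n₀ * (θ ^ q) ^ k := rfl
  have hr1 : r ≤ 1 := by
    by_contra h
    push Not at h
    obtain ⟨k, hk'⟩ := pow_unbounded_of_one_lt (Cₑ * θ ^ n₀ / v) h
    exact absurd (hr_bdd k) (not_le.2 hk')
  have hpow : Real.exp (2 * T') ^ q ≤ θ ^ q := by
    have := (div_le_one hθq).1 (by rw [← hr]; exact hr1)
    exact this
  exact (pow_le_pow_iff_left₀ (Real.exp_pos _).le hθ.le hq.ne').1 hpow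

/-- **The periodic pinned extraction with the limit's envelope kept** (as `periodicSurvivingEternalLimit_of_pinned`, plus
`e^{2σ}‖W∞_n(σ)‖² ≤ Cₑ κ₂ (Λ²μ)^n`). [cite: Tao2016AveragedNS, §4 Thm. 4.2 (statement shape), (4.8)–(4.10), §6.4; KochNadirashviliSereginSverak2009, Thm 1.1 ff.; cell vocabulary] -/
theorem periodicEnvelopedEternalLimit_of_pinned {ε₀ T C A μ Cₑ cf κ₁ κ₂ a T' : ℝ} (hε : 0 < ε₀) (hT : 0 < T)
    {α : Fin m → Fin m → Fin m → ℤ × ℤ × ℤ → ℝ}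
    {X : Fin m → ℤ → ℝ → ℝ} (hC1 : ∀ i n, ContDiffOn ℝ 1 (X i n) (Set.Ico 0 T))
    (hmot : ∀ i n t, 0 ≤ t → t < T → derivWithin (X i n) (Set.Ici 0) t = quadTerm ε₀ α X i n t)
    {W : ℤ → ℝ → Em m}
    (hW : ∀ n σ, W n σ = (bigLam ε₀ ^ n * Real.exp (-σ)) • shellVec X n (T - Real.exp (-σ)))
    (htypeI : ∀ (n : ℤ) (t : ℝ), 0 ≤ t → t < T → bigLam ε₀ ^ n * (T - t) * ‖shellVec X n t‖ ≤ C)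
    (hact : ∀ k : ℤ, IntegrableOn (fun t => ‖shellVec X k t‖) (Ico 0 T) ∧
      bigLam ε₀ ^ k * (∫ t in Ico 0 T, ‖shellVec X k t‖) ≤ A)
    (hμ : 0 < μ) (hE : ∀ (k : ℤ) (t : ℝ), 0 ≤ t → t < T → ‖shellVec X k t‖ ^ 2 ≤ Cₑ * μ ^ k)
    {τ : ℕ → ℝ} (hτ : ∀ k : ℕ, 0 ≤ τ k ∧ τ k < T)
    (hfloor : ∀ k : ℕ, cf * μ ^ k ≤ ‖shellVec X (k : ℤ) (τ k)‖ ^ 2)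
    (hclock₁ : ∀ k : ℕ, κ₁ ≤ (bigLam ε₀ ^ 2 * μ) ^ k * (T - τ k) ^ 2)
    (hclock₂ : ∀ k : ℕ, (bigLam ε₀ ^ 2 * μ) ^ k * (T - τ k) ^ 2 ≤ κ₂)
    (hcf : 0 < cf) (hκ₁ : 0 < κ₁) (hκ₂ : 0 < κ₂) (hq1 : 1 < bigLam ε₀ ^ 2 * μ)
    (hpw : 1 ≤ physWeight a ε₀ * (bigLam ε₀ ^ 2 * μ)) {q : ℕ}
    (hasym : ∀ (n : ℤ) (σ : ℝ), Tendsto (fun j : ℕ =>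
      W (n + q + (j : ℤ)) (σ + q * T' + -Real.log (T - τ j)) - W (n + (j : ℤ)) (σ + -Real.log (T - τ j)))
        atTop (𝓝 0)) :
    ∃ Wlim : ℤ → ℝ → Em m, IsEternal ε₀ α Wlim ∧ UniformBound Wlim ∧ EternalSurvivingFwd a ε₀ Wlim ∧
      (∀ (n : ℤ) (σ : ℝ), Wlim (n + q) σ = Wlim n (σ - q * T')) ∧
      (∀ (n : ℤ) (σ : ℝ), Real.exp (2 * σ) * ‖Wlim n σ‖ ^ 2 ≤ Cₑ * κ₂ * (bigLam ε₀ ^ 2 * μ) ^ n) := by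
  have hΛ : 0 < bigLam ε₀ := bigLam_pos (by linarith)
  set Q : ℝ := bigLam ε₀ ^ 2 * μ with hQ_def
  have hQ : 0 < Q := by positivity
  have gap : ∀ j : ℕ, 0 < T - τ j := fun j => by linarith [(hτ j).2]
  have hlow : ∀ j : ℕ, ((j : ℝ) * Real.log Q - Real.log κ₂) / 2 ≤ -Real.log (T - τ j) := by
    intro j
    have h1 : (T - τ j) ^ 2 ≤ κ₂ / Q ^ j := by
      rw [le_div_iff₀ (pow_pos hQ j), mul_comm]; exact hclock₂ j
    have h2 : Real.log ((T - τ j) ^ 2) ≤ Real.log (κ₂ / Q ^ j) := Real.log_le_log (pow_pos (gap j) 2) h1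
    rw [Real.log_pow, Real.log_div hκ₂.ne' (pow_pos hQ j).ne', Real.log_pow] at h2
    push_cast at h2
    linarith
  have hs : Tendsto (fun j : ℕ => -Real.log (T - τ j)) atTop atTop := by
    have hlq : 0 < Real.log Q := Real.log_pos hq1
    have h1 : Tendsto (fun j : ℕ => ((j : ℝ) * Real.log Q + -Real.log κ₂) / 2) atTop atTop :=
      (tendsto_atTop_add_const_right _ _ (tendsto_natCast_atTop_atTop.atTop_mul_const hlq)).atTop_div_const
        two_pos
    refine tendsto_atTop_mono (fun j => ?_) h1
    have := hlow j
    rwa [sub_eq_add_neg] at this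
  have hM : ∀ j : ℕ, Q ^ ((fun j : ℕ => (j : ℤ)) j) * Real.exp (-(2 * (fun j : ℕ => -Real.log (T - τ j)) j)) ≤ κ₂ := by
    intro j
    have e : Real.exp (-(2 * -Real.log (T - τ j))) = (T - τ j) ^ 2 := by
      rw [show -(2 * -Real.log (T - τ j)) = Real.log (T - τ j) + Real.log (T - τ j) by ring, Real.exp_add,
        Real.exp_log (gap j), sq]
    simp only [zpow_natCast, e]
    exact hclock₂ j
  obtain ⟨φ, hφ, Wlim, hconv, hEt, hUB, -, henv⟩ := admissibleEternalLimit_of_ceilings hε hT hC1 hmot hW htypeI hact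
    hμ hE (fun j : ℕ => (j : ℤ)) (fun j : ℕ => -Real.log (T - τ j)) hs hM
  have hconv' : ∀ (n : ℤ) (v : ℕ → ℝ) (σ : ℝ), Tendsto v atTop (𝓝 σ) →
      Tendsto (fun j => W (n + ((φ j : ℕ) : ℤ)) (v j + -Real.log (T - τ (φ j)))) atTop (𝓝 (Wlim n σ)) :=
    fun n v σ hv => by simpa only using hconv n v σ hv
  have hper : ∀ (n : ℤ) (u : ℝ), Wlim (n + q) (u + q * T') = Wlim n u := by
    intro n u
    have h1 : Tendsto (fun j => W (n + q + ((φ j : ℕ) : ℤ)) (u + q * T' + -Real.log (T - τ (φ j)))) atTop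
        (𝓝 (Wlim (n + q) (u + q * T'))) := by
      have h := hconv (n + q) (fun _ => u + q * T') (u + q * T') tendsto_const_nhds
      refine h.congr fun j => ?_
      simp only [add_assoc]
    have h2 : Tendsto (fun j => W (n + ((φ j : ℕ) : ℤ)) (u + -Real.log (T - τ (φ j)))) atTop (𝓝 (Wlim n u)) :=
      hconv n (fun _ => u) u tendsto_const_nhds
    have h3 := (hasym n u).comp hφ.tendsto_atTop
    exact sub_eq_zero.1 (tendsto_nhds_unique (h1.sub h2) h3)
  refine ⟨Wlim, hEt, hUB,
    survivingFwd_of_firingLimit hε hW hμ hcf hκ₁ hκ₂ hq1 hpw hτ hfloor hclock₁ hclock₂ (φ := φ) hconv',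
    fun n σ => ?_, henv⟩
  have h := hper n (σ - q * T')
  rw [sub_add_cancel] at h
  exact h

/-- **The extracted delay is dominated by the blow-up's retention: `μ_DSS = e^{2T'}/(1+ε₀)^5 ≤ μ`.**
[cite: Tao2016AveragedNS, §4 (4.8)–(4.10), §6.4; cell vocabulary (`dssMu`)] -/
theorem dssMu_le_of_periodicLimit {ε₀ μ T' Cₑ κ₂ : ℝ} (hε : 0 < ε₀) (hμ : 0 < μ) {W : ℤ → ℝ → Em m} {q : ℕ}
    (hq : 0 < q) (hper : ∀ (n : ℤ) (σ : ℝ), W (n + q) σ = W n (σ - q * T'))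
    (henv : ∀ (n : ℤ) (σ : ℝ), Real.exp (2 * σ) * ‖W n σ‖ ^ 2 ≤ Cₑ * κ₂ * (bigLam ε₀ ^ 2 * μ) ^ n)
    {a : ℝ} (hS : EternalSurvivingFwd a ε₀ W) : dssMu ε₀ T' ≤ μ := by
  have hΛ : 0 < bigLam ε₀ := bigLam_pos (by linarith)
  obtain ⟨n₀, σ₀, hne⟩ := exists_ne_zero_of_eternalSurvivingFwd hS
  have h := exp_delay_le_of_envelope_shiftPeriodic hq hper (by positivity : 0 < bigLam ε₀ ^ 2 * μ) henv hne
  unfold dssMu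
  rw [← bigLam_sq hε, div_le_iff₀ (pow_pos hΛ 2)]
  linarith

/-- **THE CRUX'S CONCLUSION FOR ONE TABLE from type I + pinning at `(1+ε₀)⁻¹ ≤ μ < 1` + asymptotic periodicity
(`q ≥ 1`, `T' > 0`), with NO separate hypothesis on `T'`.** [cite: Tao2016AveragedNS, §4 Thm. 4.2, (4.8)–(4.10), §6.4; KochNadirashviliSereginSverak2009, Thm 1.1 ff.; cell vocabulary (`IsDSSWave`, `Surviving`)] -/
theorem survivingDSSWave_of_periodicPinned_of_lt_one {ε₀ T C A μ Cₑ cf κ₁ κ₂ T' : ℝ} (hε : 0 < ε₀) (hT : 0 < T)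
    {α : Fin m → Fin m → Fin m → ℤ × ℤ × ℤ → ℝ}
    {X : Fin m → ℤ → ℝ → ℝ} (hC1 : ∀ i n, ContDiffOn ℝ 1 (X i n) (Set.Ico 0 T))
    (hmot : ∀ i n t, 0 ≤ t → t < T → derivWithin (X i n) (Set.Ici 0) t = quadTerm ε₀ α X i n t)
    {W : ℤ → ℝ → Em m}
    (hW : ∀ n σ, W n σ = (bigLam ε₀ ^ n * Real.exp (-σ)) • shellVec X n (T - Real.exp (-σ)))
    (htypeI : ∀ (n : ℤ) (t : ℝ), 0 ≤ t → t < T → bigLam ε₀ ^ n * (T - t) * ‖shellVec X n t‖ ≤ C)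
    (hact : ∀ k : ℤ, IntegrableOn (fun t => ‖shellVec X k t‖) (Ico 0 T) ∧
      bigLam ε₀ ^ k * (∫ t in Ico 0 T, ‖shellVec X k t‖) ≤ A)
    (hμ1 : (1 + ε₀)⁻¹ ≤ μ) (hμlt : μ < 1)
    (hE : ∀ (k : ℤ) (t : ℝ), 0 ≤ t → t < T → ‖shellVec X k t‖ ^ 2 ≤ Cₑ * μ ^ k)
    {τ : ℕ → ℝ} (hτ : ∀ k : ℕ, 0 ≤ τ k ∧ τ k < T)
    (hfloor : ∀ k : ℕ, cf * μ ^ k ≤ ‖shellVec X (k : ℤ) (τ k)‖ ^ 2)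
    (hclock₁ : ∀ k : ℕ, κ₁ ≤ (bigLam ε₀ ^ 2 * μ) ^ k * (T - τ k) ^ 2)
    (hclock₂ : ∀ k : ℕ, (bigLam ε₀ ^ 2 * μ) ^ k * (T - τ k) ^ 2 ≤ κ₂)
    (hcf : 0 < cf) (hκ₁ : 0 < κ₁) (hκ₂ : 0 < κ₂) {q : ℕ} (hq : 0 < q) (hT' : 0 < T')
    (hasym : ∀ (n : ℤ) (σ : ℝ), Tendsto (fun j : ℕ =>
      W (n + q + (j : ℤ)) (σ + q * T' + -Real.log (T - τ j)) - W (n + (j : ℤ)) (σ + -Real.log (T - τ j)))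
        atTop (𝓝 0)) :
    ∃ (q : ℕ) (π : Equiv.Perm (Fin q)) (T : ℝ) (Φ : Fin q → ℝ → Em m),
      IsDSSWave ε₀ α π T Φ ∧ Surviving 1 ε₀ T ∧ ∃ r x, Φ r x ≠ 0 := by
  have hb : (0 : ℝ) < 1 + ε₀ := by linarith
  have hμ : 0 < μ := lt_of_lt_of_le (inv_pos.2 hb) hμ1
  have hpw : 1 ≤ physWeight 1 ε₀ * (bigLam ε₀ ^ 2 * μ) :=
    physWeight_mul_ge_one_of_surviving hε (a := 1) (by rwa [Real.rpow_neg_one])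
  have hq1 : 1 < bigLam ε₀ ^ 2 * μ := by
    rw [bigLam_sq hε]
    have h4 : (1 : ℝ) < (1 + ε₀) ^ 4 := one_lt_pow₀ (by linarith) (by norm_num)
    have h5 : (1 + ε₀) ^ 4 ≤ (1 + ε₀) ^ 5 * μ := by
      calc (1 + ε₀) ^ 4 = (1 + ε₀) ^ 5 * (1 + ε₀)⁻¹ := by field_simp
        _ ≤ (1 + ε₀) ^ 5 * μ := mul_le_mul_of_nonneg_left hμ1 (pow_pos hb 5).le
    exact lt_of_lt_of_le h4 h5
  obtain ⟨Wlim, hEt, hU, hS, hper, henv⟩ := periodicEnvelopedEternalLimit_of_pinned hε hT hC1 hmot hW htypeI hact hμ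
    hE hτ hfloor hclock₁ hclock₂ hcf hκ₁ hκ₂ hq1 hpw hasym
  have hμ' : dssMu ε₀ T' < 1 := lt_of_le_of_lt (dssMu_le_of_periodicLimit hε hμ hq hper henv hS) hμlt
  exact (exists_survivingDSSWave_iff_shiftPeriodic hε).2 ⟨Wlim, q, T', hq, hT', hμ', hEt, hU, hper, hS⟩

end BlowupRigidityOne

end Summit.NavierStokesRegularity.NavierStokesRegularity.Theorems

end
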